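import Literature.MathematicalPhysics.KineticTheory.DiPernaLionsMildLimitProofs
import HarnessLib

/-!
# Bounded, compactly supported truncations of a DiPerna–Lions collision kernel

Topic: MathematicalPhysics / KineticTheory. Infrastructure for the named fact (L12)
`diPernaLions_limit_expDuhamel` (Cercignani–Illner–Pulvirenti 1994 §5.3 Lemma 5.3.12). To pass
to the limit in the gain term of the supersolution inequality (3.38) one needs collision kernels
which are bounded and vanish for large relative velocities *uniformly along the approximating
sequence* (CIP work under (3.13) `A ∈ L^∞_loc` and reduce "to bounded domains", proof of
Lemma 5.3.11 ii), p. 156; DiPerna–Lions truncate). This file records the truncations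
`kernelTrunc K B (v, v_*, ω) = min(B(v, v_*, ω), K) · 1_{‖v - v_*‖ < K}` of a kernel `B` and their
elementary properties; by monotonicity of the true gain integral (`eGain_mono`) the supersolution
inequality (3.38) holds with any kernel `0 ≤ b ≤ Bₙ`, in particular with
`min(Bₙ, kernelTrunc K B) → kernelTrunc K B`. Everything is proved; one definition.

* `kernelTrunc K B`: `0 ≤ B^K ≤ min(B, K)`, vanishing for `‖v - v_*‖ ≥ K`, measurable, with the
  Galilean invariance and the two micro-reversibility symmetries of `B`
  (`norm_collide_fst_sub_snd`: `‖v' - v_*'‖ = ‖v - v_*‖`), nondecreasing in `K` and converging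
  (eventually equal) to `B` as `K → ∞` (`kernelTrunc_mono_left`, `tendsto_kernelTrunc_atTop`,
  `iSup_ofReal_kernelTrunc_mul`);
* `min B' (kernelTrunc K B)` for a second kernel `B' ≥ 0` (the approximating kernels): between `0`
  and `B'`, at most `K`, same support, and `|min(B', B^K) - B^K| ≤ |B' - B|`
  (`abs_min_kernelTrunc_sub_le`), so that `min(Bₙ, B^K) → B^K` in `L¹_loc` and a.e. along
  `Bₙ → B`.

## References

* C. Cercignani, R. Illner, M. Pulvirenti, *The Mathematical Theory of Dilute Gases*, Springer
  (1994), §5.3 (3.12)–(3.13) (p. 143), proof of Lemma 5.3.11 ii) (p. 156), proof of Lemma 5.3.12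
  (p. 158).
* R. J. DiPerna, P.-L. Lions, Ann. of Math. 130 (1989) 321–366.
-/

open MeasureTheory Metric Real Set Filter Topology
open scoped InnerProductSpace ENNReal

noncomputable section

namespace Literature.MathematicalPhysics.KineticTheory

variable {E : Type*} [NormedAddCommGroup E]

/-! ## The relative speed is a collision invariant -/

section Collide

variable [InnerProductSpace ℝ E]

/-- **Elastic collisions preserve the relative speed**: `‖v' - v_*'‖ = ‖v - v_*‖`
(`v' - v_*' = (v - v_*) - 2⟨v - v_*, ω⟩ ω` is the reflection of `v - v_*` in `ω^⊥`; CIP 1994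
§3.1). [cite: CIPDiluteGases1994, §3.1] -/
theorem norm_collide_fst_sub_snd (ω : sphere (0 : E) 1) (p : E × E) :
    ‖(collide ω p).1 - (collide ω p).2‖ = ‖p.1 - p.2‖ := by
  have hω : ‖(ω : E)‖ = 1 := norm_eq_of_mem_sphere ω
  set z : E := p.1 - p.2 with hz
  set a : ℝ := ⟪p.1 - p.2, (ω : E)⟫_ℝ with ha
  have h1 : (collide ω p).1 - (collide ω p).2 = z - (2 * a) • (ω : E) := by
    simp only [collide, hz, ha]
    rw [mul_smul, two_smul]
    abel
  have hsq : ‖z - (2 * a) • (ω : E)‖ ^ 2 = ‖z‖ ^ 2 := by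
    rw [norm_sub_sq_real, inner_smul_right, norm_smul, hω, mul_one, Real.norm_eq_abs,
      sq_abs]
    have : ⟪z, (ω : E)⟫_ℝ = a := by rw [ha, hz]
    rw [this]
    ring
  rw [h1]
  exact (pow_left_inj₀ (norm_nonneg _) (norm_nonneg _) two_ne_zero).1 hsq

end Collide

/-! ## The truncated kernels -/

/-- The bounded, compactly supported truncation of a collision kernel at level `K`:
`B^K(v, v_*, ω) = min(B(v, v_*, ω), K)` if `‖v - v_*‖ < K`, and `0` otherwise (a kernel satisfying
Gérard's simplifying assumption (3.13) of CIP 1994 §5.3, `A ∈ L^∞`, with compact support in the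
relative velocity, increasing to `B` as `K → ∞`). [cite: CIPDiluteGases1994, §5.3 (3.13) (p. 143)] -/
def kernelTrunc (K : ℝ) (B : E × E → sphere (0 : E) 1 → ℝ) (p : E × E) (ω : sphere (0 : E) 1) : ℝ :=
  if ‖p.1 - p.2‖ < K then min (B p ω) K else 0

section Basic

variable {K : ℝ} {B : E × E → sphere (0 : E) 1 → ℝ}

/-- Unfolding of `kernelTrunc`. [folklore] -/
theorem kernelTrunc_apply (K : ℝ) (B : E × E → sphere (0 : E) 1 → ℝ) (p : E × E)
    (ω : sphere (0 : E) 1) :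
    kernelTrunc K B p ω = if ‖p.1 - p.2‖ < K then min (B p ω) K else 0 :=
  rfl

/-- `B^K ≥ 0` for `B ≥ 0`, `K ≥ 0`. [folklore] -/
theorem kernelTrunc_nonneg (hB0 : ∀ p ω, 0 ≤ B p ω) (hK : 0 ≤ K) (p : E × E)
    (ω : sphere (0 : E) 1) : 0 ≤ kernelTrunc K B p ω := by
  unfold kernelTrunc
  split_ifs
  · exact le_min (hB0 _ _) hK
  · exact le_rfl

/-- `B^K ≤ B` for `B ≥ 0`. [folklore] -/
theorem kernelTrunc_le (hB0 : ∀ p ω, 0 ≤ B p ω) (p : E × E) (ω : sphere (0 : E) 1) :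
    kernelTrunc K B p ω ≤ B p ω := by
  unfold kernelTrunc
  split_ifs
  · exact min_le_left _ _
  · exact hB0 _ _

/-- `B^K ≤ K` for `K ≥ 0`. [folklore] -/
theorem kernelTrunc_le_level (hK : 0 ≤ K) (p : E × E) (ω : sphere (0 : E) 1) :
    kernelTrunc K B p ω ≤ K := by
  unfold kernelTrunc
  split_ifs
  · exact min_le_right _ _
  · exact hK

/-- `B^K` vanishes for relative speeds `≥ K`. [folklore] -/
theorem kernelTrunc_eq_zero_of_le (p : E × E) (ω : sphere (0 : E) 1) (h : K ≤ ‖p.1 - p.2‖) :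
    kernelTrunc K B p ω = 0 := by
  unfold kernelTrunc
  rw [if_neg (not_lt.2 h)]

/-- `B^K(z, 0, ω) = 0` for `‖z‖ ≥ K` (the support condition of
`gain_loss_integrable_of_bounded_kernel`). [folklore] -/
theorem kernelTrunc_eq_zero_of_le_norm (z : E) (ω : sphere (0 : E) 1) (h : K ≤ ‖z‖) :
    kernelTrunc K B (z, 0) ω = 0 :=
  kernelTrunc_eq_zero_of_le _ _ (by simpa using h)

/-- For `‖v - v_*‖ < K` and `B ≤ K` the truncation does nothing. [folklore] -/
theorem kernelTrunc_eq_self (p : E × E) (ω : sphere (0 : E) 1) (h : ‖p.1 - p.2‖ < K)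
    (hBK : B p ω ≤ K) : kernelTrunc K B p ω = B p ω := by
  unfold kernelTrunc
  rw [if_pos h, min_eq_left hBK]

/-- Galilean invariance is inherited by `B^K`. [folklore] -/
theorem kernelTrunc_sub_right (hsub : ∀ (v w u : E) ω, B (v + u, w + u) ω = B (v, w) ω)
    (v w u : E) (ω : sphere (0 : E) 1) :
    kernelTrunc K B (v + u, w + u) ω = kernelTrunc K B (v, w) ω := by
  unfold kernelTrunc
  simp only [add_sub_add_right_eq_sub, hsub]

/-- The exchange symmetry `B(v_*, v, -ω) = B(v, v_*, ω)` is inherited by `B^K`. [folklore] -/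
theorem kernelTrunc_swap_neg (hBs : ∀ p ω, B p.swap (-ω) = B p ω) (p : E × E)
    (ω : sphere (0 : E) 1) : kernelTrunc K B p.swap (-ω) = kernelTrunc K B p ω := by
  unfold kernelTrunc
  rw [Prod.fst_swap, Prod.snd_swap, norm_sub_rev, hBs]

/-- `B^K` is nondecreasing in the level `K ≥ 0` (for `B ≥ 0`). [folklore] -/
theorem kernelTrunc_mono_left (hB0 : ∀ p ω, 0 ≤ B p ω) {K K' : ℝ} (hK : 0 ≤ K) (hKK' : K ≤ K')
    (p : E × E) (ω : sphere (0 : E) 1) : kernelTrunc K B p ω ≤ kernelTrunc K' B p ω := by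
  unfold kernelTrunc
  by_cases h : ‖p.1 - p.2‖ < K
  · rw [if_pos h, if_pos (h.trans_le hKK')]
    exact min_le_min le_rfl hKK'
  · rw [if_neg h]
    split_ifs
    · exact le_min (hB0 _ _) (hK.trans hKK')
    · exact le_rfl

/-- `B^K → B` as `K → ∞`, pointwise (indeed `B^K = B` for `K > max(‖v - v_*‖, B)`). [folklore] -/
theorem tendsto_kernelTrunc_atTop (B : E × E → sphere (0 : E) 1 → ℝ) (p : E × E)
    (ω : sphere (0 : E) 1) : Tendsto (fun K : ℝ => kernelTrunc K B p ω) atTop (𝓝 (B p ω)) := by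
  refine tendsto_const_nhds.congr' ?_
  filter_upwards [eventually_gt_atTop (max ‖p.1 - p.2‖ (B p ω))] with K hK
  rw [max_lt_iff] at hK
  exact (kernelTrunc_eq_self p ω hK.1 hK.2.le).symm

/-- Along the natural numbers, `ofReal (B^N c) ↑ ofReal (B c)` for `c ≥ 0`, `B ≥ 0`: the supremum
form used with the monotone convergence theorem. [folklore] -/
theorem iSup_ofReal_kernelTrunc_mul (hB0 : ∀ p ω, 0 ≤ B p ω) (p : E × E) (ω : sphere (0 : E) 1)
    {c : ℝ} (hc : 0 ≤ c) :
    ⨆ N : ℕ, ENNReal.ofReal (kernelTrunc N B p ω * c) = ENNReal.ofReal (B p ω * c) := by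
  have hmono : Monotone fun N : ℕ => ENNReal.ofReal (kernelTrunc N B p ω * c) := fun N N' h =>
    ENNReal.ofReal_le_ofReal (mul_le_mul_of_nonneg_right
      (kernelTrunc_mono_left hB0 (Nat.cast_nonneg N) (Nat.cast_le.2 h) p ω) hc)
  have hlim : Tendsto (fun N : ℕ => ENNReal.ofReal (kernelTrunc N B p ω * c)) atTop
      (𝓝 (ENNReal.ofReal (B p ω * c))) :=
    (ENNReal.continuous_ofReal.tendsto _).comp
      (((tendsto_kernelTrunc_atTop B p ω).comp tendsto_natCast_atTop_atTop).mul_const c)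
  exact tendsto_nhds_unique (tendsto_atTop_iSup hmono) hlim

/-- **Comparison of `min(B', B^K)` with `B^K`**: for kernels `B, B' ≥ 0`,
`|min(B', B^K) - B^K| ≤ |B' - B|` pointwise (since `B^K ≤ B`), so that `min(Bₙ, B^K) → B^K`
wherever and in whichever `L¹` sense `Bₙ → B`. [folklore] -/
theorem abs_min_kernelTrunc_sub_le (hB0 : ∀ p ω, 0 ≤ B p ω) {B' : E × E → sphere (0 : E) 1 → ℝ}
    (p : E × E) (ω : sphere (0 : E) 1) :
    |min (B' p ω) (kernelTrunc K B p ω) - kernelTrunc K B p ω| ≤ |B' p ω - B p ω| := by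
  have hle : kernelTrunc K B p ω ≤ B p ω := kernelTrunc_le hB0 p ω
  rcases le_total (B' p ω) (kernelTrunc K B p ω) with h | h
  · rw [min_eq_left h, abs_of_nonpos (sub_nonpos.2 h), abs_of_nonpos (by linarith)]
    linarith
  · rw [min_eq_right h, sub_self, abs_zero]
    exact abs_nonneg _

/-- `0 ≤ min(B', B^K)` for `B, B' ≥ 0`, `K ≥ 0`. [folklore] -/
theorem min_kernelTrunc_nonneg (hB0 : ∀ p ω, 0 ≤ B p ω) {B' : E × E → sphere (0 : E) 1 → ℝ}
    (hB'0 : ∀ p ω, 0 ≤ B' p ω) (hK : 0 ≤ K) (p : E × E) (ω : sphere (0 : E) 1) :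
    0 ≤ min (B' p ω) (kernelTrunc K B p ω) :=
  le_min (hB'0 _ _) (kernelTrunc_nonneg hB0 hK p ω)

/-- `min(B', B^K)(z, 0, ω) = 0` for `‖z‖ ≥ K` when `B' ≥ 0`. [folklore] -/
theorem min_kernelTrunc_eq_zero_of_le_norm {B' : E × E → sphere (0 : E) 1 → ℝ}
    (hB'0 : ∀ p ω, 0 ≤ B' p ω) (z : E) (ω : sphere (0 : E) 1) (h : K ≤ ‖z‖) :
    min (B' (z, 0) ω) (kernelTrunc K B (z, 0) ω) = 0 := by
  rw [kernelTrunc_eq_zero_of_le_norm z ω h, min_eq_right (hB'0 _ _)]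

end Basic

section Reversible

variable [InnerProductSpace ℝ E] {K : ℝ} {B : E × E → sphere (0 : E) 1 → ℝ}

/-- Micro-reversibility `B(v', v_*', -ω) = B(v, v_*, ω)` is inherited by `B^K` (the relative speed
is a collision invariant). [folklore] -/
theorem kernelTrunc_collide_neg (hBc : ∀ p ω, B (collide ω p) (-ω) = B p ω) (p : E × E)
    (ω : sphere (0 : E) 1) : kernelTrunc K B (collide ω p) (-ω) = kernelTrunc K B p ω := by
  unfold kernelTrunc
  rw [norm_collide_fst_sub_snd, hBc]

end Reversible

/-! ## Measurability -/

section Measurable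

variable [InnerProductSpace ℝ E] [FiniteDimensional ℝ E] [MeasurableSpace E] [BorelSpace E] {K : ℝ}
  {B : E × E → sphere (0 : E) 1 → ℝ}

/-- `B^K` is jointly measurable for measurable `B`. [folklore] -/
theorem measurable_kernelTrunc (hBm : Measurable (Function.uncurry B)) (K : ℝ) :
    Measurable (Function.uncurry (kernelTrunc K B)) := by
  have h : Function.uncurry (kernelTrunc K B) = fun q : (E × E) × sphere (0 : E) 1 =>
      if ‖q.1.1 - q.1.2‖ < K then min (Function.uncurry B q) K else 0 := by
    funext q; rfl
  rw [h]
  refine Measurable.ite ?_ (hBm.min measurable_const) measurable_const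
  exact measurableSet_lt (by fun_prop) measurable_const

/-- `min(B', B^K)` is jointly measurable for measurable `B, B'`. [folklore] -/
theorem measurable_min_kernelTrunc (hBm : Measurable (Function.uncurry B))
    {B' : E × E → sphere (0 : E) 1 → ℝ} (hB'm : Measurable (Function.uncurry B')) (K : ℝ) :
    Measurable (Function.uncurry fun p ω => min (B' p ω) (kernelTrunc K B p ω)) :=
  hB'm.min (measurable_kernelTrunc hBm K)

end Measurable

end Literature.MathematicalPhysics.KineticTheory
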